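import Summits.Langlands.Langlands.Theorems.SqrtFiveQuarticCoversGroupCensusFiveLemmas

/-!
# `SqrtFiveQuarticCovers.GroupCensusFive` — cases B and C of the structured census

Support file (`--supports stmt-Langlands-17592`) for the route item
`Summit.Langlands.Langlands.Theses.SqrtFiveQuarticCovers.GroupCensusFive` (finite census in
`GL₂(𝔽₅)`, Freitas–Le Hung–Siksek 2015, Remark (iii) after Cor. 2.1).  After a non-scalar
`g₀ ∈ G ∩ SL₂(𝔽₅)` has been put in rational canonical form (file `…GroupCensusFiveLemmas`), the
census splits by `tr g₀`.  This file treats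

* **case C** (`tr g₀ ∈ {2, 3}`, `g₀ ~ ±(1 1; 0 1)`): impossible — the annihilating functional of
  hypothesis (d) forces `G ∩ SL₂` into the Borel, irreducibility (c) forces the odd element `c`
  out of it, and `c g₀ c⁻¹ ∈ G ∩ SL₂` is then not upper triangular (`caseC`);
* **case B** (`tr g₀ = 0`, `g₀ ~ diag(2,3)`): `G` is conjugate into `H8 = ⟨diag(2,3), antidiag(1,1)⟩`
  (`caseB`, via the upper-triangular sub-case `caseB_upper` and a conjugation by `antidiag(1,1)`),

together with the two uses of irreducibility (`false_of_forall_upper`, `forall_upper_of`).  Case A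
(`tr g₀ ∈ {1, 4}`, `H12`) and the assembly are in `…GroupCensusFive.lean`.  Every residual finite
check is a `decide` over at most six elements of `ZMod 5`.  No definitions; standard axioms only.
References: [FreitasLeHungSiksek2015] Invent. Math. 201 (2015), Remark (iii) after Cor. 2.1.
-/

set_option linter.dupNamespace false -- project-wide option (lakefile weak.linter.dupNamespace); `Summit.Langlands.Langlands` is the mandated namespace

namespace Summit.Langlands.Langlands.Theorems.GroupCensusFive

open Matrix

/-! ## 5. Using irreducibility: not everything is upper triangular -/

/-- If every element of `G` is upper triangular then `e₀` is a common eigenvector — excluded by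
hypothesis (c). [folklore] -/
theorem false_of_forall_upper {G : Subgroup (GL (Fin 2) (ZMod 5))}
    (hirr : ¬ ∃ v : Fin 2 → ZMod 5, v ≠ 0 ∧ ∀ g ∈ G, ∃ a : ZMod 5,
      ((g : GL (Fin 2) (ZMod 5)) : Matrix (Fin 2) (Fin 2) (ZMod 5)) *ᵥ v = a • v)
    (hup : ∀ g ∈ G, ((g : GL (Fin 2) (ZMod 5)) : Matrix (Fin 2) (Fin 2) (ZMod 5)) 1 0 = 0) : False := by
  refine hirr ⟨![1, 0], ?_, fun g hg => ⟨(g : Matrix (Fin 2) (Fin 2) (ZMod 5)) 0 0, ?_⟩⟩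
  · intro h
    exact absurd (congr_fun h 0) (by decide)
  · ext i
    fin_cases i <;> simp [Matrix.mulVec, dotProduct, Fin.sum_univ_two, hup g hg]

/-- If the determinant-one part of `G` is upper triangular and so is the odd element `c`, then all
of `G = G⁺ ∪ G⁺c` is upper triangular. [folklore] -/
theorem forall_upper_of {G : Subgroup (GL (Fin 2) (ZMod 5))}
    (hdet : ∀ g ∈ G, Matrix.det ((g : GL (Fin 2) (ZMod 5)) : Matrix (Fin 2) (Fin 2) (ZMod 5)) = 1 ∨
      Matrix.det ((g : GL (Fin 2) (ZMod 5)) : Matrix (Fin 2) (Fin 2) (ZMod 5)) = -1)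
    {c : GL (Fin 2) (ZMod 5)} (hcG : c ∈ G)
    (hctr : Matrix.trace (c : Matrix (Fin 2) (Fin 2) (ZMod 5)) = 0)
    (hcdet : Matrix.det (c : Matrix (Fin 2) (Fin 2) (ZMod 5)) = -1)
    (hup : ∀ g ∈ G, Matrix.det ((g : GL (Fin 2) (ZMod 5)) : Matrix (Fin 2) (Fin 2) (ZMod 5)) = 1 →
      ((g : GL (Fin 2) (ZMod 5)) : Matrix (Fin 2) (Fin 2) (ZMod 5)) 1 0 = 0)
    (hc10 : (c : Matrix (Fin 2) (Fin 2) (ZMod 5)) 1 0 = 0) :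
    ∀ g ∈ G, ((g : GL (Fin 2) (ZMod 5)) : Matrix (Fin 2) (Fin 2) (ZMod 5)) 1 0 = 0 := by
  intro g hg
  rcases hdet g hg with hd | hd
  · exact hup g hg hd
  · have hgc : ((g * c : GL (Fin 2) (ZMod 5)) : Matrix (Fin 2) (Fin 2) (ZMod 5)) 1 0 = 0 :=
      hup (g * c) (G.mul_mem hg hcG) (det_mul_eq_one_of_det_eq_neg_one hd hcdet)
    have hg' : (g : Matrix (Fin 2) (Fin 2) (ZMod 5)) =
        ((g * c : GL (Fin 2) (ZMod 5)) : Matrix (Fin 2) (Fin 2) (ZMod 5)) * (c : Matrix (Fin 2) (Fin 2) (ZMod 5)) := by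
      rw [← Units.val_mul, mul_assoc, mul_self_eq_one_of_trace_zero c hctr hcdet, mul_one]
    rw [hg']
    simp only [Matrix.mul_apply, Fin.sum_univ_two, hgc, hc10, mul_zero, zero_mul, add_zero]

/-! ## 6. Case C: a transvection of determinant one in `G` is impossible -/

/-- **Case `tr g₀ ∈ {2, 3}`.** If `G` (hypotheses (a)–(d), (d) as a functional) contains `n` with
matrix `(s s; 0 s)`, `s = ±1`, we reach a contradiction: the functional forces every
determinant-one element to be upper triangular (else `1, n, h, n h` already span `M₂(𝔽₅)`),
irreducibility forces `c ∉ B`, and then `c n c⁻¹ ∈ G ∩ SL₂` is not upper triangular. [folklore] -/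
theorem caseC {G : Subgroup (GL (Fin 2) (ZMod 5))}
    (hdet : ∀ g ∈ G, Matrix.det ((g : GL (Fin 2) (ZMod 5)) : Matrix (Fin 2) (Fin 2) (ZMod 5)) = 1 ∨
      Matrix.det ((g : GL (Fin 2) (ZMod 5)) : Matrix (Fin 2) (Fin 2) (ZMod 5)) = -1)
    {c : GL (Fin 2) (ZMod 5)} (hcG : c ∈ G)
    (hctr : Matrix.trace (c : Matrix (Fin 2) (Fin 2) (ZMod 5)) = 0)
    (hcdet : Matrix.det (c : Matrix (Fin 2) (Fin 2) (ZMod 5)) = -1)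
    (hirr : ¬ ∃ v : Fin 2 → ZMod 5, v ≠ 0 ∧ ∀ g ∈ G, ∃ a : ZMod 5,
      ((g : GL (Fin 2) (ZMod 5)) : Matrix (Fin 2) (Fin 2) (ZMod 5)) *ᵥ v = a • v)
    {φ : Matrix (Fin 2) (Fin 2) (ZMod 5) →ₗ[ZMod 5] ZMod 5} (hφ0 : φ ≠ 0)
    (hφ : ∀ g ∈ G, Matrix.det (g : Matrix (Fin 2) (Fin 2) (ZMod 5)) = 1 →
      φ (g : Matrix (Fin 2) (Fin 2) (ZMod 5)) = 0)
    {s : ZMod 5} (hs : s = 1 ∨ s = 4)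
    {n : GL (Fin 2) (ZMod 5)} (hnG : n ∈ G) (hn : (n : Matrix (Fin 2) (Fin 2) (ZMod 5)) = !![s, s; 0, s]) :
    False := by
  have hndet : Matrix.det (n : Matrix (Fin 2) (Fin 2) (ZMod 5)) = 1 := by
    rw [hn, Matrix.det_fin_two_of]; rcases hs with rfl | rfl <;> decide
  have hw : ¬ (φ !![1, 0; 0, 0] = 0 ∧ φ !![0, 1; 0, 0] = 0 ∧ φ !![0, 0; 1, 0] = 0 ∧ φ !![0, 0; 0, 1] = 0) :=
    fun h => hφ0 (functional_eq_zero φ h)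
  have e1 := hφ 1 G.one_mem (by simp)
  have en := hφ n hnG hndet
  rw [functional_apply] at e1 en
  rw [hn] at en
  simp only [Units.val_one, Matrix.one_apply_eq, Matrix.one_apply_ne, ne_eq, zero_ne_one,
    one_ne_zero, not_false_eq_true, Matrix.of_apply, Matrix.cons_val', Matrix.cons_val_zero,
    Matrix.cons_val_one, Matrix.cons_val_fin_one, Matrix.empty_val'] at e1 en
  -- C1: every determinant-one element of `G` is upper triangular
  have hup : ∀ h ∈ G, Matrix.det ((h : GL (Fin 2) (ZMod 5)) : Matrix (Fin 2) (Fin 2) (ZMod 5)) = 1 →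
      ((h : GL (Fin 2) (ZMod 5)) : Matrix (Fin 2) (Fin 2) (ZMod 5)) 1 0 = 0 := by
    intro h hh hhd
    obtain ⟨p, q, r, t, hh'⟩ := exists_eq_fin_two (h : Matrix (Fin 2) (Fin 2) (ZMod 5))
    have eh := hφ h hh hhd
    have enh := hφ (n * h) (G.mul_mem hnG hh)
      (by rw [Units.val_mul, Matrix.det_mul, hndet, hhd, one_mul])
    rw [functional_apply] at eh enh
    rw [Units.val_mul, hn, hh'] at enh
    rw [hh'] at eh ⊢
    simp only [Matrix.mul_fin_two, Matrix.of_apply, Matrix.cons_val', Matrix.cons_val_zero,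
      Matrix.cons_val_one, Matrix.cons_val_fin_one, Matrix.empty_val'] at eh enh ⊢
    generalize φ !![1, 0; 0, 0] = w00 at hw e1 en eh enh
    generalize φ !![0, 1; 0, 0] = w01 at hw e1 en eh enh
    generalize φ !![0, 0; 1, 0] = w10 at hw e1 en eh enh
    generalize φ !![0, 0; 0, 1] = w11 at hw e1 en eh enh
    have hw1 : w01 = 0 ∧ w00 = -w11 := by
      clear eh enh hw
      rcases hs with rfl | rfl
      · revert w00 w01 w10 w11 e1 en; decide
      · revert w00 w01 w10 w11 e1 en; decide
    obtain ⟨rfl, rfl⟩ := hw1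
    clear e1 en hh' hh hhd
    simp only [zero_mul, mul_zero, add_zero, zero_add] at eh enh
    rcases hs with rfl | rfl
    · revert p r t w10 w11 hw eh enh; decide
    · revert p r t w10 w11 hw eh enh; decide
  -- C2: `c` is not upper triangular
  have hc10 : (c : Matrix (Fin 2) (Fin 2) (ZMod 5)) 1 0 ≠ 0 :=
    fun h0 => false_of_forall_upper hirr (forall_upper_of hdet hcG hctr hcdet hup h0)
  -- C3: but `c n c⁻¹ = c n c ∈ G ∩ SL₂` must be upper triangular: contradiction
  have hcnc : ((c * n * c : GL (Fin 2) (ZMod 5)) : Matrix (Fin 2) (Fin 2) (ZMod 5)) 1 0 = 0 :=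
    hup _ (G.mul_mem (G.mul_mem hcG hnG) hcG)
      (by rw [Units.val_mul, Units.val_mul, Matrix.det_mul, Matrix.det_mul, hcdet, hndet]; norm_num)
  obtain ⟨c1, c2, c3, c4, hc⟩ := exists_eq_fin_two (c : Matrix (Fin 2) (Fin 2) (ZMod 5))
  rw [Units.val_mul, Units.val_mul, hc, hn] at hcnc
  rw [hc, Matrix.trace_fin_two_of] at hctr
  rw [hc, Matrix.det_fin_two_of] at hcdet
  rw [hc] at hc10
  simp only [Matrix.mul_fin_two, Matrix.of_apply, Matrix.cons_val', Matrix.cons_val_zero,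
    Matrix.cons_val_one, Matrix.cons_val_fin_one, Matrix.empty_val'] at hcnc hc10
  clear hc hup e1 en hw hndet hn
  rcases hs with rfl | rfl
  · revert c1 c2 c3 c4 hctr hcdet hc10 hcnc; decide
  · revert c1 c2 c3 c4 hctr hcdet hc10 hcnc; decide


/-! ## 7. Case B: `diag(2, 3) ∈ G` — the split Cartan normaliser `H8` -/

/-- **Case `tr g₀ = 0`, upper-triangular sub-case.** If `G` (hypotheses (a)–(c)) contains `n` with
matrix `diag(2,3)` and every determinant-one element of `G` is upper triangular, then `G ≤ H8`
on the nose: irreducibility forces `c ∉ B`, `c n c⁻¹ ∈ B` forces `c` antidiagonal, and then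
`c h c⁻¹ ∈ B` forces every `h ∈ G ∩ SL₂` to be diagonal; `G = (G ∩ SL₂) ∪ (G ∩ SL₂) c`. [folklore] -/
theorem caseB_upper {G : Subgroup (GL (Fin 2) (ZMod 5))}
    (hdet : ∀ g ∈ G, Matrix.det ((g : GL (Fin 2) (ZMod 5)) : Matrix (Fin 2) (Fin 2) (ZMod 5)) = 1 ∨
      Matrix.det ((g : GL (Fin 2) (ZMod 5)) : Matrix (Fin 2) (Fin 2) (ZMod 5)) = -1)
    {c : GL (Fin 2) (ZMod 5)} (hcG : c ∈ G)
    (hctr : Matrix.trace (c : Matrix (Fin 2) (Fin 2) (ZMod 5)) = 0)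
    (hcdet : Matrix.det (c : Matrix (Fin 2) (Fin 2) (ZMod 5)) = -1)
    (hirr : ¬ ∃ v : Fin 2 → ZMod 5, v ≠ 0 ∧ ∀ g ∈ G, ∃ a : ZMod 5,
      ((g : GL (Fin 2) (ZMod 5)) : Matrix (Fin 2) (Fin 2) (ZMod 5)) *ᵥ v = a • v)
    {n : GL (Fin 2) (ZMod 5)} (hnG : n ∈ G) (hn : (n : Matrix (Fin 2) (Fin 2) (ZMod 5)) = !![2, 0; 0, 3])
    (hup : ∀ g ∈ G, Matrix.det ((g : GL (Fin 2) (ZMod 5)) : Matrix (Fin 2) (Fin 2) (ZMod 5)) = 1 →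
      ((g : GL (Fin 2) (ZMod 5)) : Matrix (Fin 2) (Fin 2) (ZMod 5)) 1 0 = 0) :
    ∃ x : GL (Fin 2) (ZMod 5), (∀ g ∈ G, x * g * x⁻¹ ∈ Subgroup.closure ({(⟨!![2, 0; 0, 3], !![3, 0; 0, 2], by decide, by decide⟩ : GL (Fin 2) (ZMod 5)), (⟨!![0, 1; 1, 0], !![0, 1; 1, 0], by decide, by decide⟩ : GL (Fin 2) (ZMod 5))} : Set (GL (Fin 2) (ZMod 5)))) ∨ (∀ g ∈ G, x * g * x⁻¹ ∈ Subgroup.closure ({(⟨!![3, 1; 3, 3], !![3, 4; 2, 3], by decide, by decide⟩ : GL (Fin 2) (ZMod 5)), (⟨!![1, 0; 0, 4], !![1, 0; 0, 4], by decide, by decide⟩ : GL (Fin 2) (ZMod 5))} : Set (GL (Fin 2) (ZMod 5)))) := by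
  have hcc := mul_self_eq_one_of_trace_zero c hctr hcdet
  have hndet : Matrix.det (n : Matrix (Fin 2) (Fin 2) (ZMod 5)) = 1 := by
    rw [hn, Matrix.det_fin_two_of]; decide
  -- U1: `c` is not upper triangular
  have hc10 : (c : Matrix (Fin 2) (Fin 2) (ZMod 5)) 1 0 ≠ 0 :=
    fun h0 => false_of_forall_upper hirr (forall_upper_of hdet hcG hctr hcdet hup h0)
  -- U2: `c` is antidiagonal
  obtain ⟨c1, c2, c3, c4, hc⟩ := exists_eq_fin_two (c : Matrix (Fin 2) (Fin 2) (ZMod 5))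
  have hcnc : ((c * n * c : GL (Fin 2) (ZMod 5)) : Matrix (Fin 2) (Fin 2) (ZMod 5)) 1 0 = 0 :=
    hup _ (G.mul_mem (G.mul_mem hcG hnG) hcG)
      (by rw [Units.val_mul, Units.val_mul, Matrix.det_mul, Matrix.det_mul, hcdet, hndet]; norm_num)
  have hc14 : c1 = 0 ∧ c4 = 0 := by
    rw [Units.val_mul, Units.val_mul, hc, hn] at hcnc
    rw [hc, Matrix.trace_fin_two_of] at hctr
    rw [hc, Matrix.det_fin_two_of] at hcdet
    rw [hc] at hc10
    simp only [Matrix.mul_fin_two, Matrix.of_apply, Matrix.cons_val', Matrix.cons_val_zero,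
      Matrix.cons_val_one, Matrix.cons_val_fin_one, Matrix.empty_val'] at hcnc hc10
    clear hc hup hn hndet hcc
    revert c1 c2 c3 c4 hctr hcdet hc10 hcnc; decide
  obtain ⟨rfl, rfl⟩ := hc14
  -- U3: every determinant-one element of `G` is diagonal
  have hdiag : ∀ g ∈ G, Matrix.det ((g : GL (Fin 2) (ZMod 5)) : Matrix (Fin 2) (Fin 2) (ZMod 5)) = 1 →
      ((g : GL (Fin 2) (ZMod 5)) : Matrix (Fin 2) (Fin 2) (ZMod 5)) 0 1 = 0 := by
    intro h hh hhd
    have hchc : ((c * h * c : GL (Fin 2) (ZMod 5)) : Matrix (Fin 2) (Fin 2) (ZMod 5)) 1 0 = 0 :=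
      hup _ (G.mul_mem (G.mul_mem hcG hh) hcG)
        (by rw [Units.val_mul, Units.val_mul, Matrix.det_mul, Matrix.det_mul, hcdet, hhd]; norm_num)
    obtain ⟨p, q, r, t, hh'⟩ := exists_eq_fin_two (h : Matrix (Fin 2) (Fin 2) (ZMod 5))
    rw [Units.val_mul, Units.val_mul, hc, hh'] at hchc
    rw [hc] at hc10
    rw [hh']
    simp only [Matrix.mul_fin_two, Matrix.of_apply, Matrix.cons_val', Matrix.cons_val_zero,
      Matrix.cons_val_one, Matrix.cons_val_fin_one, Matrix.empty_val', mul_zero, zero_mul, add_zero,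
      zero_add] at hchc hc10 ⊢
    clear hh' hh hhd hc hcnc hup hn hndet hcc
    revert c3 q hc10 hchc; decide
  -- U4: conclude with `x = 1`
  refine ⟨1, Or.inl fun g hg => ?_⟩
  rw [one_mul, inv_one, mul_one]
  apply mem_H8_of_shape
  rcases hdet g hg with hd | hd
  · exact Or.inl ⟨hdiag g hg hd, hup g hg hd, hd⟩
  · right
    have hgc1 : Matrix.det ((g * c : GL (Fin 2) (ZMod 5)) : Matrix (Fin 2) (Fin 2) (ZMod 5)) = 1 :=
      det_mul_eq_one_of_det_eq_neg_one hd hcdet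
    have h1 := hdiag (g * c) (G.mul_mem hg hcG) hgc1
    have h2 := hup (g * c) (G.mul_mem hg hcG) hgc1
    have hg' : (g : Matrix (Fin 2) (Fin 2) (ZMod 5)) =
        ((g * c : GL (Fin 2) (ZMod 5)) : Matrix (Fin 2) (Fin 2) (ZMod 5)) * (c : Matrix (Fin 2) (Fin 2) (ZMod 5)) := by
      rw [← Units.val_mul, mul_assoc, hcc, mul_one]
    obtain ⟨p, q, r, t, hgc⟩ := exists_eq_fin_two ((g * c : GL (Fin 2) (ZMod 5)) : Matrix (Fin 2) (Fin 2) (ZMod 5))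
    rw [hgc] at h1 h2 hg'
    rw [hc] at hg'
    simp only [Matrix.of_apply, Matrix.cons_val', Matrix.cons_val_zero, Matrix.cons_val_one,
      Matrix.cons_val_fin_one, Matrix.empty_val'] at h1 h2
    subst h1 h2
    refine ⟨?_, ?_, hd⟩ <;> rw [hg', Matrix.mul_fin_two] <;> simp

/-- **Case `tr g₀ = 0`.** If `G` (hypotheses (a)–(d), (d) as a functional) contains `n` with matrix
`diag(2,3)`, then `G` is conjugate into `H8`: the functional forces every `h ∈ G ∩ SL₂` to be
upper or lower triangular (else `1, n, h, n h` span `M₂(𝔽₅)`) and indeed all on the same side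
(else again the functional vanishes); the lower case is the upper case conjugated by
`antidiag(1,1)`. [folklore] -/
theorem caseB {G : Subgroup (GL (Fin 2) (ZMod 5))}
    (hdet : ∀ g ∈ G, Matrix.det ((g : GL (Fin 2) (ZMod 5)) : Matrix (Fin 2) (Fin 2) (ZMod 5)) = 1 ∨
      Matrix.det ((g : GL (Fin 2) (ZMod 5)) : Matrix (Fin 2) (Fin 2) (ZMod 5)) = -1)
    {c : GL (Fin 2) (ZMod 5)} (hcG : c ∈ G)
    (hctr : Matrix.trace (c : Matrix (Fin 2) (Fin 2) (ZMod 5)) = 0)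
    (hcdet : Matrix.det (c : Matrix (Fin 2) (Fin 2) (ZMod 5)) = -1)
    (hirr : ¬ ∃ v : Fin 2 → ZMod 5, v ≠ 0 ∧ ∀ g ∈ G, ∃ a : ZMod 5,
      ((g : GL (Fin 2) (ZMod 5)) : Matrix (Fin 2) (Fin 2) (ZMod 5)) *ᵥ v = a • v)
    {φ : Matrix (Fin 2) (Fin 2) (ZMod 5) →ₗ[ZMod 5] ZMod 5} (hφ0 : φ ≠ 0)
    (hφ : ∀ g ∈ G, Matrix.det (g : Matrix (Fin 2) (Fin 2) (ZMod 5)) = 1 →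
      φ (g : Matrix (Fin 2) (Fin 2) (ZMod 5)) = 0)
    {n : GL (Fin 2) (ZMod 5)} (hnG : n ∈ G) (hn : (n : Matrix (Fin 2) (Fin 2) (ZMod 5)) = !![2, 0; 0, 3]) :
    ∃ x : GL (Fin 2) (ZMod 5), (∀ g ∈ G, x * g * x⁻¹ ∈ Subgroup.closure ({(⟨!![2, 0; 0, 3], !![3, 0; 0, 2], by decide, by decide⟩ : GL (Fin 2) (ZMod 5)), (⟨!![0, 1; 1, 0], !![0, 1; 1, 0], by decide, by decide⟩ : GL (Fin 2) (ZMod 5))} : Set (GL (Fin 2) (ZMod 5)))) ∨ (∀ g ∈ G, x * g * x⁻¹ ∈ Subgroup.closure ({(⟨!![3, 1; 3, 3], !![3, 4; 2, 3], by decide, by decide⟩ : GL (Fin 2) (ZMod 5)), (⟨!![1, 0; 0, 4], !![1, 0; 0, 4], by decide, by decide⟩ : GL (Fin 2) (ZMod 5))} : Set (GL (Fin 2) (ZMod 5)))) := by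
  have hndet : Matrix.det (n : Matrix (Fin 2) (Fin 2) (ZMod 5)) = 1 := by
    rw [hn, Matrix.det_fin_two_of]; decide
  have hw : ¬ (φ !![1, 0; 0, 0] = 0 ∧ φ !![0, 1; 0, 0] = 0 ∧ φ !![0, 0; 1, 0] = 0 ∧ φ !![0, 0; 0, 1] = 0) :=
    fun h => hφ0 (functional_eq_zero φ h)
  have e1 := hφ 1 G.one_mem (by simp)
  have en := hφ n hnG hndet
  rw [functional_apply] at e1 en
  rw [hn] at en
  simp only [Units.val_one, Matrix.one_apply_eq, Matrix.one_apply_ne, ne_eq, zero_ne_one,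
    one_ne_zero, not_false_eq_true, Matrix.of_apply, Matrix.cons_val', Matrix.cons_val_zero,
    Matrix.cons_val_one, Matrix.cons_val_fin_one, Matrix.empty_val'] at e1 en
  have hw0011 : φ !![1, 0; 0, 0] = 0 ∧ φ !![0, 0; 0, 1] = 0 := by
    generalize φ !![1, 0; 0, 0] = w00 at e1 en ⊢
    generalize φ !![0, 1; 0, 0] = w01 at e1 en ⊢
    generalize φ !![0, 0; 1, 0] = w10 at e1 en ⊢
    generalize φ !![0, 0; 0, 1] = w11 at e1 en ⊢
    clear hw hn hndet
    revert w00 w01 w10 w11 e1 en; decide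
  -- L1: every determinant-one element is upper or lower triangular
  have hul : ∀ h ∈ G, Matrix.det ((h : GL (Fin 2) (ZMod 5)) : Matrix (Fin 2) (Fin 2) (ZMod 5)) = 1 →
      ((h : GL (Fin 2) (ZMod 5)) : Matrix (Fin 2) (Fin 2) (ZMod 5)) 0 1 = 0 ∨
      ((h : GL (Fin 2) (ZMod 5)) : Matrix (Fin 2) (Fin 2) (ZMod 5)) 1 0 = 0 := by
    intro h hh hhd
    obtain ⟨p, q, r, t, hh'⟩ := exists_eq_fin_two (h : Matrix (Fin 2) (Fin 2) (ZMod 5))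
    have eh := hφ h hh hhd
    have enh := hφ (n * h) (G.mul_mem hnG hh)
      (by rw [Units.val_mul, Matrix.det_mul, hndet, hhd, one_mul])
    rw [functional_apply] at eh enh
    rw [Units.val_mul, hn, hh'] at enh
    rw [hh'] at eh ⊢
    simp only [Matrix.mul_fin_two, Matrix.of_apply, Matrix.cons_val', Matrix.cons_val_zero,
      Matrix.cons_val_one, Matrix.cons_val_fin_one, Matrix.empty_val', hw0011.1, hw0011.2] at eh enh ⊢
    generalize φ !![0, 1; 0, 0] = w01 at hw eh enh
    generalize φ !![0, 0; 1, 0] = w10 at hw eh enh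
    rw [hw0011.1, hw0011.2] at hw
    clear e1 en hh' hh hhd hw0011
    simp only [mul_zero, zero_mul, add_zero, zero_add] at eh enh
    revert q r w01 w10 hw eh enh; decide
  -- L2: all upper, or all lower
  by_cases hU : ∀ h ∈ G, Matrix.det ((h : GL (Fin 2) (ZMod 5)) : Matrix (Fin 2) (Fin 2) (ZMod 5)) = 1 →
      ((h : GL (Fin 2) (ZMod 5)) : Matrix (Fin 2) (Fin 2) (ZMod 5)) 1 0 = 0
  · exact caseB_upper hdet hcG hctr hcdet hirr hnG hn hU
  by_cases hL : ∀ h ∈ G, Matrix.det ((h : GL (Fin 2) (ZMod 5)) : Matrix (Fin 2) (Fin 2) (ZMod 5)) = 1 →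
      ((h : GL (Fin 2) (ZMod 5)) : Matrix (Fin 2) (Fin 2) (ZMod 5)) 0 1 = 0
  · -- conjugate by `w = antidiag(1,1)` to land in the upper-triangular sub-case
    let w : GL (Fin 2) (ZMod 5) := ⟨!![0, 1; 1, 0], !![0, 1; 1, 0], by decide, by decide⟩
    refine concl_transfer w (caseB_upper (det_transfer w hdet) (odd_transfer w hcG hctr hcdet).1
      (odd_transfer w hcG hctr hcdet).2.1 (odd_transfer w hcG hctr hcdet).2.2 (irr_transfer w hirr)
      (n := w * n⁻¹ * w⁻¹) (conj_mem_map_conj (G.inv_mem hnG)) ?_ ?_)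
    · have hninv : n⁻¹ = ⟨!![3, 0; 0, 2], !![2, 0; 0, 3], by decide, by decide⟩ := by
        refine inv_eq_of_mul_eq_one_right (Units.ext ?_)
        rw [Units.val_mul, hn]
        decide
      rw [hninv]
      decide
    · intro g hg hgd
      have hmem := mem_map_conj_iff.1 hg
      have hgd' : Matrix.det ((w⁻¹ * g * w : GL (Fin 2) (ZMod 5)) : Matrix (Fin 2) (Fin 2) (ZMod 5)) = 1 := by
        rw [Units.val_mul, Units.val_mul, Matrix.det_units_conj']; exact hgd
      have h01 := hL _ hmem hgd'
      obtain ⟨p, q, r, t, hg'⟩ := exists_eq_fin_two (g : Matrix (Fin 2) (Fin 2) (ZMod 5))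
      rw [Units.val_mul, Units.val_mul, hg'] at h01
      rw [hg']
      change ((!![0, 1; 1, 0] : Matrix (Fin 2) (Fin 2) (ZMod 5)) * !![p, q; r, t] *
        (!![0, 1; 1, 0] : Matrix (Fin 2) (Fin 2) (ZMod 5))) 0 1 = 0 at h01
      simpa using h01
  · exfalso
    push Not at hU hL
    obtain ⟨h₁, hh₁, hd₁, hne₁⟩ := hU
    obtain ⟨h₂, hh₂, hd₂, hne₂⟩ := hL
    have h₁01 : ((h₁ : GL (Fin 2) (ZMod 5)) : Matrix (Fin 2) (Fin 2) (ZMod 5)) 0 1 = 0 :=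
      (hul h₁ hh₁ hd₁).resolve_right hne₁
    have h₂10 : ((h₂ : GL (Fin 2) (ZMod 5)) : Matrix (Fin 2) (Fin 2) (ZMod 5)) 1 0 = 0 :=
      (hul h₂ hh₂ hd₂).resolve_left hne₂
    have e₁ := hφ h₁ hh₁ hd₁
    have e₂ := hφ h₂ hh₂ hd₂
    rw [functional_apply, hw0011.1, hw0011.2, h₁01] at e₁
    rw [functional_apply, hw0011.1, hw0011.2, h₂10] at e₂
    rw [hw0011.1, hw0011.2] at hw
    generalize φ !![0, 1; 0, 0] = w01 at hw e₁ e₂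
    generalize φ !![0, 0; 1, 0] = w10 at hw e₁ e₂
    generalize ((h₁ : GL (Fin 2) (ZMod 5)) : Matrix (Fin 2) (Fin 2) (ZMod 5)) 1 0 = r₁ at hne₁ e₁
    generalize ((h₂ : GL (Fin 2) (ZMod 5)) : Matrix (Fin 2) (Fin 2) (ZMod 5)) 0 1 = q₂ at hne₂ e₂
    generalize ((h₁ : GL (Fin 2) (ZMod 5)) : Matrix (Fin 2) (Fin 2) (ZMod 5)) 0 0 = a₁ at e₁
    generalize ((h₁ : GL (Fin 2) (ZMod 5)) : Matrix (Fin 2) (Fin 2) (ZMod 5)) 1 1 = d₁ at e₁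
    generalize ((h₂ : GL (Fin 2) (ZMod 5)) : Matrix (Fin 2) (Fin 2) (ZMod 5)) 0 0 = a₂ at e₂
    generalize ((h₂ : GL (Fin 2) (ZMod 5)) : Matrix (Fin 2) (Fin 2) (ZMod 5)) 1 1 = d₂ at e₂
    simp only [mul_zero, zero_mul, add_zero, zero_add] at e₁ e₂
    clear h₁01 h₂10 hd₁ hd₂ hh₁ hh₂ hul hw0011 e1 en hn hndet
    revert w01 w10 r₁ q₂ hne₁ hne₂ e₁ e₂ hw; decide


end Summit.Langlands.Langlands.Theorems.GroupCensusFive
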